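import Summits.BirchSwinnertonDyer.BirchSwinnertonDyer.Theorems.CyclotomicUntwistGNineLeafFrobeniusTrace
import Summits.BirchSwinnertonDyer.BirchSwinnertonDyer.Theorems.CyclotomicUntwistGNineArithmetic
import Summits.BirchSwinnertonDyer.BirchSwinnertonDyer.Theorems.CyclotomicUntwistPSUntwistedTraceInvariance
import Summits.BirchSwinnertonDyer.BirchSwinnertonDyer.Theorems.CyclotomicUntwistPSUntwistedTraceQuadraticTwist
import HarnessLib

/-!
# LAW L-a3 (N) over `ℚ(ζ₉)`, cubic level — TOOLS: the cusp translation and the `√−3`-rescaling carried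
# on the `F`-side (Frobenius trace) and on the `ℚ`-side (closed form `psUntwistedTrace`)
# (route `CyclotomicUntwist`, cruxes K1 / K2)

Cell `pub/bsd-wall` (D-0145 line `route-BirchSwinnertonDyer-CyclotomicUntwist`), seat `bsd-line-cycu-p3`
(gen 7). Helper toward K1 `PSRankOneLowerHalfAtThree` (stmt-BirchSwinnertonDyer-21580) / K2 (21581).
THEOREMS ONLY (no definition, no named fact, no `sorry`); BSD is not proved by this file and no crux is.

The tools of the cubic-level law (`CyclotomicUntwistGNineCubicFrobeniusTrace`), which runs cycu-p2's
`GNineCriterion` reduction (cusp translation; residue patterns; the `√−3`-rescaling `(2ζ³+1, 0, 0, 0)` for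
`v₃(disc) ≥ 8`, which over `F ∋ ζ₉ ∋ √−3` is an `F`-ISOMORPHISM) with the Frobenius trace carried along on the
`F`-side (`frobeniusTraceAt_smul`, Silverman VII.1.3(b)) and the closed form (N′) carried along on the `ℚ`-side
(`psUntwistedTrace_variableChange`, p620627; `untwistedTraceOfInvariants_negTwentySeven_mul`, p621340):

* `translate_smul`, `cubicModel_smul` — the two changes of variables as equations (any ring / field);
* `cubic_Δ_eq_disc`, `cubic_c₆_eq` (`c₆ = −32·P`, `P = 2A³ − 9AB + 27C`), `csix_translate`, `csix_twist`
  (`P(9a,27b,27c) = −27·P(−3a,3b,−c)`), `cubic_int_Δ_ne_zero`;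
* `false_of_IzeroStar_shape` — the I₀*-shaped branch `(3a, 9b, 27c)` of `pattern_six` is EXCLUDED by
  `3⁵ ∥ P` (it has `v₃P ∈ {3} ∪ [6, ∞)`): this is where the route's binder `f₃ ≠ 2` enters, through the
  Kraus/Papadopoulos middle entry `v₃c₆ = 5` on the Kodaira-IV rows (`PSKrausC6Parity`, W-level file);
* `psUntwistedTrace_cubic_translate`, `psUntwistedTrace_cubic_twist` (the `ℚ`-side);
  `frobeniusTraceAt_cubic_translate`, `twist_smul`, `frobeniusTraceAt_cubic_twist` (the `F`-side).

References: J. Tate, LNM 476 (1975) §7 [Tate1975]; A. Kraus, Manuscripta Math. 69 (1990), Théorème (p = 3)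
[Kraus1990]; J. H. Silverman, *AEC* III.1, VII.1 Prop. 1.3(b), C.§16 [SilvermanAEC2009].
-/

-- single-conjunct summit: `Summit.BirchSwinnertonDyer.BirchSwinnertonDyer.…` repeats the name by design
set_option linter.dupNamespace false
set_option autoImplicit false

noncomputable section

open scoped NumberField Classical

open IsDedekindDomain IsDedekindDomain.HeightOneSpectrum NumberField WeierstrassCurve WithZero
  Literature.NumberTheory.EllipticCurves
  Summit.BirchSwinnertonDyer.BirchSwinnertonDyer.Theorems.GNine
  Summit.BirchSwinnertonDyer.BirchSwinnertonDyer.Theorems.GNineCriterion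

namespace Summit.BirchSwinnertonDyer.BirchSwinnertonDyer.Theorems.GNineFrobeniusTrace

/-! ### Changes of variables as equations -/

/-- The translation `(1, t, 0, 0)` on a cubic model (any commutative ring). [cite: SilvermanAEC2009, III.1 Table 3.1] -/
theorem translate_smul {R : Type*} [CommRing R] (A B C t : R) :
    (⟨1, t, 0, 0⟩ : VariableChange R) • (⟨0, A, 0, B, C⟩ : WeierstrassCurve R) =
      ⟨0, A + 3 * t, 0, B + 2 * t * A + 3 * t ^ 2, C + t * B + t ^ 2 * A + t ^ 3⟩ := by
  rw [variableChange_def]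
  simp only [inv_one, Units.val_one, WeierstrassCurve.mk.injEq]
  refine ⟨?_, ?_, ?_, ?_, ?_⟩ <;> ring

/-- Completing the square and clearing `2`: `(1/2, 0, −a₁/2, −a₃/2) • V = y² = x³ + b₂x² + 8b₄x + 16b₆`
(any field with `2 ≠ 0`). [cite: SilvermanAEC2009, III.1] -/
theorem cubicModel_smul {K : Type*} [Field K] (h2 : (2 : K) ≠ 0) (V : WeierstrassCurve K) :
    (⟨Units.mk0 (2 : K)⁻¹ (inv_ne_zero h2), 0, -V.a₁ / 2, -V.a₃ / 2⟩ : VariableChange K) • V =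
      ⟨0, V.b₂, 0, 8 * V.b₄, 16 * V.b₆⟩ := by
  set Cv : VariableChange K := ⟨Units.mk0 (2 : K)⁻¹ (inv_ne_zero h2), 0, -V.a₁ / 2, -V.a₃ / 2⟩ with hCv
  have hCu : (↑Cv.u⁻¹ : K) = 2 := by
    rw [Units.val_inv_eq_inv_val, hCv, Units.val_mk0, inv_inv]
  ext
  · rw [variableChange_a₁, hCu]; simp only [hCv]; field_simp; ring
  · rw [variableChange_a₂, hCu]; simp only [hCv, WeierstrassCurve.b₂]; field_simp; ring
  · rw [variableChange_a₃, hCu]; simp only [hCv]; field_simp; ring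
  · rw [variableChange_a₄, hCu]; simp only [hCv, WeierstrassCurve.b₄]; field_simp; ring
  · rw [variableChange_a₆, hCu]; simp only [hCv, WeierstrassCurve.b₆]; field_simp; ring

/-! ### Integer bookkeeping: `Δ = 16·disc`, `c₆ = −32·P` -/

/-- `Δ(y² = x³ + Ax² + Bx + C) = 16·disc` in the ordering of `GNineCriterion`. [folklore] -/
theorem cubic_Δ_eq_disc {R : Type*} [CommRing R] (A B C : R) :
    (⟨0, A, 0, B, C⟩ : WeierstrassCurve R).Δ =
      16 * (A ^ 2 * B ^ 2 - 4 * B ^ 3 - 4 * A ^ 3 * C - 27 * C ^ 2 + 18 * A * B * C) := by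
  rw [cubic_Δ]; ring

/-- `c₆(y² = x³ + Ax² + Bx + C) = −32·(2A³ − 9AB + 27C)`. [cite: SilvermanAEC2009, III.1] -/
theorem cubic_c₆_eq {R : Type*} [CommRing R] (A B C : R) :
    (⟨0, A, 0, B, C⟩ : WeierstrassCurve R).c₆ = -32 * (2 * A ^ 3 - 9 * A * B + 27 * C) := by
  simp only [WeierstrassCurve.c₆, WeierstrassCurve.b₂, WeierstrassCurve.b₄, WeierstrassCurve.b₆]
  ring

/-- `P = 2A³ − 9AB + 27C` (`= −c₆/32`) is invariant under `x ↦ x + t`. [folklore] -/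
theorem csix_translate (A B C t : ℤ) :
    2 * (A + 3 * t) ^ 3 - 9 * (A + 3 * t) * (B + 2 * t * A + 3 * t ^ 2) + 27 * (C + t * B + t ^ 2 * A + t ^ 3) =
      2 * A ^ 3 - 9 * A * B + 27 * C := by
  ring

/-- `P(9a, 27b, 27c) = −27·P(−3a, 3b, −c)` (the `√−3`-rescaling multiplies `c₆` by `(−3)³`). [folklore] -/
theorem csix_twist (a b c : ℤ) :
    2 * (9 * a) ^ 3 - 9 * (9 * a) * (27 * b) + 27 * (27 * c) =
      -27 * (2 * (-(3 * a)) ^ 3 - 9 * (-(3 * a)) * (3 * b) + 27 * (-c)) := by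
  ring

/-- The integer cubic with `disc = 3^v·d`, `d ≡ 1 (mod 3)`, has non-zero discriminant. [folklore] -/
theorem cubic_int_Δ_ne_zero {A B C : ℤ} {v : ℕ} {d : ℤ}
    (hD : A ^ 2 * B ^ 2 - 4 * B ^ 3 - 4 * A ^ 3 * C - 27 * C ^ 2 + 18 * A * B * C = 3 ^ v * d)
    (hd : d % 3 = 1) : (⟨0, A, 0, B, C⟩ : WeierstrassCurve ℤ).Δ ≠ 0 := by
  rw [cubic_Δ_eq_disc, hD]
  have hd0 : d ≠ 0 := by rintro rfl; simp at hd
  exact mul_ne_zero (by norm_num) (mul_ne_zero (pow_ne_zero _ (by norm_num)) hd0)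

/-- **The I₀*-shaped branch is excluded by `3⁵ ∥ P`.** For `(A, B, C) = (3a, 9b, 27c)`:
`P = 27·(2a³ − 9ab + 27c)` has `v₃P = 3` if `3 ∤ a` and `v₃P ≥ 6` if `3 ∣ a`; never `5`.
[cite: Papadopoulos1993, Table (p = 3)] -/
theorem false_of_IzeroStar_shape (a b c : ℤ)
    (h5 : (3 : ℤ) ^ 5 ∣ 2 * (3 * a) ^ 3 - 9 * (3 * a) * (9 * b) + 27 * (27 * c))
    (h6 : ¬ (3 : ℤ) ^ 6 ∣ 2 * (3 * a) ^ 3 - 9 * (3 * a) * (9 * b) + 27 * (27 * c)) : False := by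
  by_cases h3a : (3 : ℤ) ∣ a
  · obtain ⟨a', rfl⟩ := h3a
    exact h6 ⟨2 * a' ^ 3 - a' * b + c, by ring⟩
  · obtain ⟨k, hk⟩ := h5
    -- `3⁵ ∣ 27·(2a³ − 9ab + 27c)` ⟹ `3 ∣ 2a³` ⟹ `3 ∣ a`
    have h3 : (3 : ℤ) ∣ 2 * a ^ 3 := ⟨3 * k + 3 * (a * b) - 9 * c, by linarith⟩
    have hz : ((2 * a ^ 3 : ℤ) : ZMod 3) = 0 := (ZMod.intCast_zmod_eq_zero_iff_dvd _ 3).mpr h3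
    have ha : ((a : ℤ) : ZMod 3) ≠ 0 := fun h ↦ h3a ((ZMod.intCast_zmod_eq_zero_iff_dvd a 3).mp h)
    push_cast at hz
    have key : ∀ x : ZMod 3, x ≠ 0 → 2 * x ^ 3 ≠ 0 := by decide
    exact key _ ha hz

/-! ### The `ℚ`-side: the closed form (N′) along translation and the `√−3`-rescaling -/

/-- (N′) is invariant under the cusp translation. [cite: Rizzo2003, §1.2 (any equation)] -/
theorem psUntwistedTrace_cubic_translate (A B C t : ℤ) (hΔ : (⟨0, A, 0, B, C⟩ : WeierstrassCurve ℤ).Δ ≠ 0) :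
    ((⟨0, A + 3 * t, 0, B + 2 * t * A + 3 * t ^ 2, C + t * B + t ^ 2 * A + t ^ 3⟩ : WeierstrassCurve ℤ).map
        (Int.castRingHom ℚ)).psUntwistedTrace =
      ((⟨0, A, 0, B, C⟩ : WeierstrassCurve ℤ).map (Int.castRingHom ℚ)).psUntwistedTrace := by
  have hΔQ : ((⟨0, A, 0, B, C⟩ : WeierstrassCurve ℤ).map (Int.castRingHom ℚ)).Δ ≠ 0 := by
    rw [map_Δ, eq_intCast]; exact_mod_cast hΔ
  have h := PSUntwistedTrace.psUntwistedTrace_variableChange ⟨1, (t : ℚ), 0, 0⟩ _ hΔQ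
  rw [cubic_map, eq_intCast, eq_intCast, eq_intCast, translate_smul] at h
  rw [cubic_map, eq_intCast, eq_intCast, eq_intCast]
  push_cast
  exact h

/-- (N′) along the `√−3`-rescaling: `psUntwistedTrace (9a, 27b, 27c) = psUntwistedTrace (−3a, 3b, −c)`
(`c₆ ↦ (−3)³c₆`, `Δ ↦ 3⁶Δ`: p621340). [cite: Kraus1990, Théorème (p = 3)] -/
theorem psUntwistedTrace_cubic_twist (a b c : ℤ)
    (hΔ : (⟨0, -(3 * a), 0, 3 * b, -c⟩ : WeierstrassCurve ℤ).Δ ≠ 0) :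
    ((⟨0, 9 * a, 0, 27 * b, 27 * c⟩ : WeierstrassCurve ℤ).map (Int.castRingHom ℚ)).psUntwistedTrace =
      ((⟨0, -(3 * a), 0, 3 * b, -c⟩ : WeierstrassCurve ℤ).map (Int.castRingHom ℚ)).psUntwistedTrace := by
  rw [cubic_map, cubic_map, eq_intCast, eq_intCast, eq_intCast, eq_intCast, eq_intCast, eq_intCast,
    PSUntwistedTrace.psUntwistedTrace_def, PSUntwistedTrace.psUntwistedTrace_def,
    cubic_c₆_eq, cubic_c₆_eq, cubic_Δ_eq_disc, cubic_Δ_eq_disc]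
  have hΔQ : (16 : ℚ) * (((-(3 * a) : ℤ) : ℚ) ^ 2 * ((3 * b : ℤ) : ℚ) ^ 2 - 4 * ((3 * b : ℤ) : ℚ) ^ 3
      - 4 * ((-(3 * a) : ℤ) : ℚ) ^ 3 * ((-c : ℤ) : ℚ) - 27 * ((-c : ℤ) : ℚ) ^ 2
      + 18 * ((-(3 * a) : ℤ) : ℚ) * ((3 * b : ℤ) : ℚ) * ((-c : ℤ) : ℚ)) ≠ 0 := by
    rw [cubic_Δ_eq_disc] at hΔ
    exact_mod_cast hΔ
  have e6 : (-32 : ℚ) * (2 * ((9 * a : ℤ) : ℚ) ^ 3 - 9 * ((9 * a : ℤ) : ℚ) * ((27 * b : ℤ) : ℚ) + 27 * ((27 * c : ℤ) : ℚ)) =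
      -27 * ((-32 : ℚ) * (2 * ((-(3 * a) : ℤ) : ℚ) ^ 3 - 9 * ((-(3 * a) : ℤ) : ℚ) * ((3 * b : ℤ) : ℚ)
        + 27 * ((-c : ℤ) : ℚ))) := by
    push_cast; ring
  have eΔ : (16 : ℚ) * (((9 * a : ℤ) : ℚ) ^ 2 * ((27 * b : ℤ) : ℚ) ^ 2 - 4 * ((27 * b : ℤ) : ℚ) ^ 3
      - 4 * ((9 * a : ℤ) : ℚ) ^ 3 * ((27 * c : ℤ) : ℚ) - 27 * ((27 * c : ℤ) : ℚ) ^ 2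
      + 18 * ((9 * a : ℤ) : ℚ) * ((27 * b : ℤ) : ℚ) * ((27 * c : ℤ) : ℚ)) =
      729 * ((16 : ℚ) * (((-(3 * a) : ℤ) : ℚ) ^ 2 * ((3 * b : ℤ) : ℚ) ^ 2 - 4 * ((3 * b : ℤ) : ℚ) ^ 3
        - 4 * ((-(3 * a) : ℤ) : ℚ) ^ 3 * ((-c : ℤ) : ℚ) - 27 * ((-c : ℤ) : ℚ) ^ 2
        + 18 * ((-(3 * a) : ℤ) : ℚ) * ((3 * b : ℤ) : ℚ) * ((-c : ℤ) : ℚ))) := by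
    push_cast; ring
  rw [e6, eΔ]
  exact PSUntwistedTrace.untwistedTraceOfInvariants_negTwentySeven_mul _ hΔQ

/-! ### The `F`-side: the Frobenius trace along translation and the `√−3`-rescaling -/

section FSide

variable {F : Type} [Field F] [NumberField F] {ζ : F} (w : HeightOneSpectrum (𝓞 F))

/-- `a_w` is invariant under the cusp translation (at a place of good reduction).
[cite: SilvermanAEC2009, VII.1 Prop. 1.3(b) and C.§16] -/
theorem frobeniusTraceAt_cubic_translate (A B C t : ℤ) (hΔ : (⟨0, A, 0, B, C⟩ : WeierstrassCurve ℤ).Δ ≠ 0)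
    (hgood : (⟨0, (A : F), 0, (B : F), (C : F)⟩ : WeierstrassCurve F).HasGoodReductionAt w) :
    (⟨0, ((A + 3 * t : ℤ) : F), 0, ((B + 2 * t * A + 3 * t ^ 2 : ℤ) : F),
        ((C + t * B + t ^ 2 * A + t ^ 3 : ℤ) : F)⟩ : WeierstrassCurve F).frobeniusTraceAt w =
      (⟨0, (A : F), 0, (B : F), (C : F)⟩ : WeierstrassCurve F).frobeniusTraceAt w := by
  haveI : (⟨0, (A : F), 0, (B : F), (C : F)⟩ : WeierstrassCurve F).IsElliptic := isElliptic_cubic_intCast hΔ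
  have h := WeierstrassCurve.frobeniusTraceAt_smul (⟨0, (A : F), 0, (B : F), (C : F)⟩ : WeierstrassCurve F)
    ⟨1, (t : F), 0, 0⟩ w hgood
  rw [translate_smul] at h
  have e : (⟨0, ((A + 3 * t : ℤ) : F), 0, ((B + 2 * t * A + 3 * t ^ 2 : ℤ) : F),
      ((C + t * B + t ^ 2 * A + t ^ 3 : ℤ) : F)⟩ : WeierstrassCurve F) =
      ⟨0, (A : F) + 3 * (t : F), 0, (B : F) + 2 * (t : F) * (A : F) + 3 * (t : F) ^ 2,
        (C : F) + (t : F) * (B : F) + (t : F) ^ 2 * (A : F) + (t : F) ^ 3⟩ := by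
    ext <;> push_cast <;> ring
  rw [e, h]

/-- **The `√−3`-rescaling is an `F`-isomorphism**: `(σ, 0, 0, 0) • (9a, 27b, 27c) = (−3a, 3b, −c)` for
`σ = 2ζ³ + 1` (`σ² = −3`). [cite: SilvermanAEC2009, III.1 Table 3.1] -/
theorem twist_smul (hζ : IsPrimitiveRoot ζ 9) (a b c : ℤ) :
    (⟨Units.mk0 (2 * ζ ^ 3 + 1 : F) (sigma_ne_zero hζ), 0, 0, 0⟩ : VariableChange F) •
        (⟨0, ((9 * a : ℤ) : F), 0, ((27 * b : ℤ) : F), ((27 * c : ℤ) : F)⟩ : WeierstrassCurve F) =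
      ⟨0, ((-(3 * a) : ℤ) : F), 0, ((3 * b : ℤ) : F), ((-c : ℤ) : F)⟩ := by
  have hσ := sigma_sq hζ
  rw [chg_smul_cubic (2 * ζ ^ 3 + 1 : F) (sigma_ne_zero hζ)]
  have hs2 : (2 * ζ ^ 3 + 1 : F)⁻¹ ^ 2 = -1 / 3 := by rw [inv_pow, hσ]; norm_num
  have hs4 : (2 * ζ ^ 3 + 1 : F)⁻¹ ^ 4 = 1 / 9 := by rw [show (4 : ℕ) = 2 * 2 from rfl, pow_mul, hs2]; norm_num
  have hs6 : (2 * ζ ^ 3 + 1 : F)⁻¹ ^ 6 = -1 / 27 := by rw [show (6 : ℕ) = 2 * 3 from rfl, pow_mul, hs2]; norm_num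
  rw [hs2, hs4, hs6]
  ext <;> push_cast <;> ring

/-- `a_w` along the `√−3`-rescaling: `a_w(9a, 27b, 27c) = a_w(−3a, 3b, −c)` (at a place of good
reduction). [cite: SilvermanAEC2009, VII.1 Prop. 1.3(b) and C.§16] -/
theorem frobeniusTraceAt_cubic_twist (hζ : IsPrimitiveRoot ζ 9) (a b c : ℤ)
    (hΔ : (⟨0, 9 * a, 0, 27 * b, 27 * c⟩ : WeierstrassCurve ℤ).Δ ≠ 0)
    (hgood : (⟨0, ((9 * a : ℤ) : F), 0, ((27 * b : ℤ) : F), ((27 * c : ℤ) : F)⟩ :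
      WeierstrassCurve F).HasGoodReductionAt w) :
    (⟨0, ((9 * a : ℤ) : F), 0, ((27 * b : ℤ) : F), ((27 * c : ℤ) : F)⟩ : WeierstrassCurve F).frobeniusTraceAt w =
      (⟨0, ((-(3 * a) : ℤ) : F), 0, ((3 * b : ℤ) : F), ((-c : ℤ) : F)⟩ : WeierstrassCurve F).frobeniusTraceAt w := by
  haveI : (⟨0, ((9 * a : ℤ) : F), 0, ((27 * b : ℤ) : F), ((27 * c : ℤ) : F)⟩ : WeierstrassCurve F).IsElliptic :=
    isElliptic_cubic_intCast hΔ
  have h := WeierstrassCurve.frobeniusTraceAt_smul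
    (⟨0, ((9 * a : ℤ) : F), 0, ((27 * b : ℤ) : F), ((27 * c : ℤ) : F)⟩ : WeierstrassCurve F)
    ⟨Units.mk0 (2 * ζ ^ 3 + 1 : F) (sigma_ne_zero hζ), 0, 0, 0⟩ w hgood
  rw [twist_smul hζ] at h
  exact h.symm

end FSide

end Summit.BirchSwinnertonDyer.BirchSwinnertonDyer.Theorems.GNineFrobeniusTrace

end
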